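import Mathlib
import Literature.Analysis.FluidPDE.SelfSimilarCollapseAnsatz
import Literature.Analysis.FluidPDE.ClassicalSolution
import Literature.Analysis.FluidPDE.VectorCalculus

/-!
# Crux E `PowerGaugeEulerLiouville` (route `EulerZoomLiouville`, stmt-NavierStokesRegularity-19832) — binder twins of THE ONE OPEN
# STATEMENT `Sig.stub_selfSimilarC2Needle` (`Cruxes/PowerGaugeEulerLiouville/Lines/birth.lean` v35, sha16 5ba6a2de3b8b3422, l.637),
# the statement WITHOUT ITS CLASS HYPOTHESIS, and two DECORATIVE binders

Negative-side record (refuter seat ns-regularity-refuter1 g9, KILLSHEET K-63; D-0081 §C), file 1 of 3.  The open stub reads: in the window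
`0 < ρ ≤ ½`, an exactly self-similar member of Seregin's power-gauged Euler class with an EXTREMAL `C²` velocity profile that is NOT tame,
NOT critically homogeneous, at `ρ = ½` WITHOUT the power spread, NOT symmetric-weak and NOT classical-concentrating is trivial.

* §0: verbatim binder twins of the seven line predicates and `SelfSimilarC2NeedleWithoutClass` = the stub with the single hypothesis
  `InClass ρ u p H c` deleted (refuted in file 3, `stub_selfSimilarC2Needle_false_without_class`).
* §1: `isTameC2Profile_of_isClassicalConcentrating`, `isTameC2Profile_of_isPowerSpreadProfile` — for an exactly self-similar member with a
  `C²` profile, `IsClassicalConcentrating` (its sup bound (a) at `τ = −1` makes the profile bounded) and `IsPowerSpreadProfile` (its a.e.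
  sublinear upper half holds everywhere by continuity) each IMPLY `IsTameC2Profile`; so in the stub the binders `¬ IsClassicalConcentrating ρ u p`
  and `¬ (ρ = ½ ∧ IsPowerSpreadProfile V)` are implied by `¬ IsTameC2Profile ρ V` — the residual member is characterised by `InClass`, exact
  self-similarity, extremality, `C²`, `¬ tame`, `¬ homogeneous`, `¬ symmetric-weak` alone.

bears_on: N0 stmt-NavierStokesRegularity-19832 (crux E `PowerGaugeEulerLiouville`, OPEN) via the v35 residual stub; consumer = the line's
planner / LEAD (binder hygiene, prover brief).  WHAT THIS IS NOT: not a claim about Navier–Stokes regularity or blow-up; not a refutation of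
the stub, of crux E or of the route; no landed theorem is contradicted. [folklore]
-/

noncomputable section

set_option linter.dupNamespace false

namespace Summit.NavierStokesRegularity.NavierStokesRegularity.Theorems.PowerGaugeEulerLiouville.Negative

open MeasureTheory Set Function Filter Topology Metric
open scoped RealInnerProductSpace NNReal ENNReal Topology ContDiff
open Literature.Analysis Literature.Analysis.FluidPDE

local notation "E3" => EuclideanSpace ℝ (Fin 3)

/-! ## §0 Binder twins of the line predicates (verbatim bodies of `…Cruxes.PowerGaugeEulerLiouville.Birth`, v35) -/

/-- binder twin of `Birth.IsExactlySelfSimilar` (v35 l.305): `u(τ) = (−τ)^{γ−1} V((−τ)^{−γ}·)`, `p(τ) = (−τ)^{2(γ−1)} P((−τ)^{−γ}·)`,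
`γ = 1/(2+ρ)`, for `τ < 0`. -/
@[reducible] def IsExactlySelfSimilar (ρ : ℝ) (u : ℝ → E3 → E3) (p : ℝ → E3 → ℝ) (V : E3 → E3) (P : E3 → ℝ) :
    Prop :=
  (∀ τ : ℝ, τ < 0 → u τ = Literature.Analysis.FluidPDE.selfSimilarCollapse (1 / (2 + ρ)) 0 V τ) ∧
    (∀ τ : ℝ, τ < 0 → p τ = Literature.Analysis.FluidPDE.selfSimilarCollapsePressure (1 / (2 + ρ)) 0 P τ)

/-- binder twin of `Birth.IsExtremalProfile` (v35 l.313): `L^{2ρ−1}∫_{B_L}|V|²` eventually bounded below. -/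
@[reducible] def IsExtremalProfile (ρ : ℝ) (V : E3 → E3) : Prop :=
  ∃ ε : ℝ, 0 < ε ∧ ∃ L₀ : ℝ, ∀ L : ℝ, L₀ ≤ L →
    ε ≤ L ^ (2 * ρ - 1) * ∫ y in Metric.ball (0 : E3) L, ‖V y‖ ^ 2

/-- binder twin of `Birth.IsHomogeneousProfile` (v35 l.320): `V (s • y) = s^{−(1+ρ)} • V y`. -/
@[reducible] def IsHomogeneousProfile (ρ : ℝ) (V : E3 → E3) : Prop :=
  ∀ s : ℝ, 0 < s → ∀ y : E3, V (s • y) = s ^ (-(1 + ρ)) • V y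

/-- binder twin of `Birth.IsTameC2Profile` (v35 l.333): `C²` and (no fast radial inflow far out ∨ uniformly continuous ∨
irrotational ∨ compactly supported vorticity). -/
@[reducible] def IsTameC2Profile (ρ : ℝ) (V : E3 → E3) : Prop :=
  ContDiff ℝ 2 V ∧
    ((∃ κ R₁ : ℝ, κ < 1 / (2 + ρ) ∧ ∀ y : E3, R₁ ≤ ‖y‖ → -(κ * ‖y‖ ^ 2) ≤ inner ℝ y (V y)) ∨ UniformContinuous V ∨
      (∀ x : E3, Literature.Analysis.FluidPDE.curl V x = 0) ∨
      HasCompactSupport (Literature.Analysis.FluidPDE.curl V))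

/-- binder twin of `Birth.IsPowerSpreadProfile` (v35 l.375): Chae–Shvydkoy's a.e. power spread at infinity. -/
@[reducible] def IsPowerSpreadProfile (V : E3 → E3) : Prop :=
  (∃ δ Cup R₀ : ℝ, 0 < δ ∧ δ ≤ 1 ∧ 0 ≤ Cup ∧
      ∀ᵐ y ∂(volume : MeasureTheory.Measure E3), R₀ ≤ ‖y‖ → ‖V y‖ ≤ Cup * ‖y‖ ^ (1 - δ)) ∧
    ∃ c₀ δ' R₀' : ℝ, 0 < c₀ ∧ 0 < δ' ∧
      ∀ᵐ y ∂(volume : MeasureTheory.Measure E3), R₀' ≤ ‖y‖ → c₀ * ‖y‖ ^ (-(4 - δ')) ≤ ‖V y‖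

/-- binder twin of `Birth.IsSymmetricWeak` (v35 l.497): time-periodic ∨ traveling wave ∨ screw-symmetric modulus. -/
@[reducible] def IsSymmetricWeak (u : ℝ → E3 → E3) (H : ℝ → E3 → E3 →L[ℝ] E3) : Prop :=
  (∃ P : ℝ, 0 < P ∧ ∀ τ : ℝ, τ < 0 → u (τ - P) = u τ) ∨
    (∃ (U : E3 → E3) (G₀ : E3 → E3 →L[ℝ] E3) (b : E3),
        u = (fun τ y => U (y - τ • b)) ∧ H = fun τ y => G₀ (y - τ • b)) ∨
    ∃ (L : E3 ≃ₗᵢ[ℝ] E3) (y₀ w : E3), w ≠ 0 ∧ L w = w ∧ ∀ τ : ℝ, τ < 0 → ∀ y : E3, ‖u τ (L (y - y₀) + y₀ + w)‖ = ‖u τ y‖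

/-- binder twin of `Birth.IsClassicalConcentrating` (v35 l.509): classical Euler on the past with the class-rate sup bounds
(a) `‖u(τ,x)‖ ≤ M(−τ)^{γ−1}`, (d), (b), (c) and `u(τ) ∈ L²`. -/
@[reducible] def IsClassicalConcentrating (ρ : ℝ) (u : ℝ → E3 → E3) (p : ℝ → E3 → ℝ) : Prop :=
  Literature.Analysis.FluidPDE.IsClassicalEulerSolutionOn (Set.Iio 0) 0 u p ∧
    (∃ M : ℝ, ∀ τ : ℝ, τ < 0 → ∀ x, ‖u τ x‖ ≤ M * (-τ) ^ (1 / (2 + ρ) - 1)) ∧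
    (∃ K : ℝ, ∀ τ : ℝ, τ < 0 → ∀ x, ‖fderiv ℝ (u τ) x‖ ≤ K / (-τ)) ∧
    (∀ ε : ℝ, 0 < ε → ∃ R : ℝ, 0 ≤ R ∧ ∀ τ : ℝ, τ < 0 → ∀ x : E3,
      R * (-τ) ^ (1 / (2 + ρ)) ≤ ‖x‖ → ‖fderiv ℝ (u τ) x‖ ≤ ε / (-τ)) ∧
    (∃ β C R₀ : ℝ, 0 < β ∧ 0 ≤ R₀ ∧ ∀ τ : ℝ, τ < 0 → ∀ r : ℝ, R₀ * (-τ) ^ (1 / (2 + ρ)) ≤ r →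
      ∫ x in {x | r ≤ ‖x‖}, ‖u τ x‖ ^ 2 ≤ C * r ^ (-β) * (-τ) ^ (1 / (2 + ρ) * β)) ∧
    (∀ τ : ℝ, τ < 0 → MeasureTheory.Integrable (fun x => ‖u τ x‖ ^ 2) volume)

/-- `Birth.Sig.stub_selfSimilarC2Needle` (v35 l.637) with the single hypothesis `InClass ρ u p H c` DELETED (and with it the binder
`c : ℝ≥0`, which occurred only there); every other binder verbatim. -/
def SelfSimilarC2NeedleWithoutClass : Prop :=
  ∀ ρ : ℝ, 0 < ρ → ρ ≤ 1 / 2 →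
    ∀ (u : ℝ → E3 → E3) (p : ℝ → E3 → ℝ) (H : ℝ → E3 → E3 →L[ℝ] E3) (V : E3 → E3) (P : E3 → ℝ),
      IsExactlySelfSimilar ρ u p V P → IsExtremalProfile ρ V → ContDiff ℝ 2 V →
        ¬ IsTameC2Profile ρ V → ¬ IsHomogeneousProfile ρ V → ¬ (ρ = 1 / 2 ∧ IsPowerSpreadProfile V) →
        ¬ IsSymmetricWeak u H → ¬ IsClassicalConcentrating ρ u p →
        Function.uncurry u =ᵐ[volume.restrict (Set.Iio (0 : ℝ) ×ˢ (Set.univ : Set E3))] 0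


/-! ## §1 Two decorative binders of the stub -/

/-- for an exactly self-similar member, the time-`−1` slice IS the profile. -/
theorem profile_eq_slice {ρ : ℝ} {u : ℝ → E3 → E3} {p : ℝ → E3 → ℝ} {V : E3 → E3} {P : E3 → ℝ}
    (hss : IsExactlySelfSimilar ρ u p V P) : u (-1) = V := by
  rw [hss.1 (-1) (by norm_num)]
  funext x
  simp

/-- **Decorative binder 1.** For an exactly self-similar member with a `C²` velocity profile, `IsClassicalConcentrating` implies
`IsTameC2Profile` (its sup bound (a) at `τ = −1` makes `V` bounded, and a bounded profile has no fast radial inflow: `⟪y, V y⟫ ≥ −M‖y‖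
≥ −κ‖y‖²` for `‖y‖ ≥ M/κ`, `κ = 1/(2(2+ρ))`).  Hence in the needle stub `¬ IsClassicalConcentrating ρ u p` is implied by
`¬ IsTameC2Profile ρ V`. [folklore] -/
theorem isTameC2Profile_of_isClassicalConcentrating {ρ : ℝ} (hρ : 0 < ρ) {u : ℝ → E3 → E3} {p : ℝ → E3 → ℝ}
    {V : E3 → E3} {P : E3 → ℝ} (hss : IsExactlySelfSimilar ρ u p V P) (hV : ContDiff ℝ 2 V)
    (hcc : IsClassicalConcentrating ρ u p) : IsTameC2Profile ρ V := by
  obtain ⟨-, ⟨M, hM⟩, -⟩ := hcc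
  have hb : ∀ x : E3, ‖V x‖ ≤ M := by
    intro x
    have hh := hM (-1) (by norm_num) x
    rw [profile_eq_slice hss] at hh
    simpa using hh
  have hM0 : 0 ≤ M := le_trans (norm_nonneg _) (hb 0)
  have h2ρ : 0 < 2 + ρ := by linarith
  set κ : ℝ := 1 / (2 * (2 + ρ)) with hκ
  have hκpos : 0 < κ := by positivity
  have hκlt : κ < 1 / (2 + ρ) := by
    rw [hκ, div_lt_div_iff_of_pos_left one_pos (by positivity) h2ρ]
    linarith
  refine ⟨hV, Or.inl ⟨κ, M / κ, hκlt, fun y hy => ?_⟩⟩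
  have hMy : M ≤ κ * ‖y‖ := by rwa [div_le_iff₀' hκpos] at hy
  have h1 : -(‖y‖ * ‖V y‖) ≤ inner ℝ y (V y) := neg_le_of_abs_le (abs_real_inner_le_norm y (V y))
  have h2 : ‖y‖ * ‖V y‖ ≤ ‖y‖ * M := mul_le_mul_of_nonneg_left (hb y) (norm_nonneg _)
  have h3 : ‖y‖ * M ≤ ‖y‖ * (κ * ‖y‖) := mul_le_mul_of_nonneg_left hMy (norm_nonneg _)
  nlinarith

/-- an a.e. upper bound for a continuous profile holds everywhere on the open exterior region. -/
theorem bound_of_ae_bound {V : E3 → E3} (hV : Continuous V) {δ Cup R₀ : ℝ} (hδ : δ ≤ 1)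
    (h : ∀ᵐ y ∂(volume : MeasureTheory.Measure E3), R₀ ≤ ‖y‖ → ‖V y‖ ≤ Cup * ‖y‖ ^ (1 - δ)) :
    ∀ y : E3, R₀ < ‖y‖ → ‖V y‖ ≤ Cup * ‖y‖ ^ (1 - δ) := by
  intro y₀ hy₀
  by_contra hlt
  rw [not_le] at hlt
  set O : Set E3 := {y : E3 | R₀ < ‖y‖ ∧ Cup * ‖y‖ ^ (1 - δ) < ‖V y‖} with hO
  have hcont : Continuous fun y : E3 => Cup * ‖y‖ ^ (1 - δ) :=
    continuous_const.mul (continuous_norm.rpow_const fun _ => Or.inr (by linarith))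
  have hOopen : IsOpen O :=
    (isOpen_lt continuous_const continuous_norm).inter (isOpen_lt hcont hV.norm)
  have hOpos : 0 < volume O := hOopen.measure_pos volume ⟨y₀, hy₀, hlt⟩
  rw [ae_iff] at h
  have hOsub : O ⊆ {y : E3 | ¬ (R₀ ≤ ‖y‖ → ‖V y‖ ≤ Cup * ‖y‖ ^ (1 - δ))} := by
    rintro y ⟨hy1, hy2⟩
    simp only [Set.mem_setOf_eq, Classical.not_imp, not_le]
    exact ⟨hy1.le, hy2⟩
  exact hOpos.ne' (measure_mono_null hOsub h)

/-- **Decorative binder 2.** For a `C²` (indeed continuous) velocity profile, Chae–Shvydkoy's power spread — already its a.e.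
sublinear UPPER half `‖V y‖ ≤ C‖y‖^{1−δ}` — implies `IsTameC2Profile ρ V` for every `ρ > −2`: the bound holds everywhere far out by
continuity, and a sublinear profile has no fast radial inflow (`⟪y, V y⟫ ≥ −C‖y‖^{2−δ} ≥ −κ‖y‖²` once `‖y‖^δ ≥ C/κ`).  Hence in the
needle stub `¬ (ρ = ½ ∧ IsPowerSpreadProfile V)` is implied by `¬ IsTameC2Profile ρ V`. [folklore] -/
theorem isTameC2Profile_of_isPowerSpreadProfile {ρ : ℝ} (hρ : 0 < ρ) {V : E3 → E3} (hV : ContDiff ℝ 2 V)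
    (hps : IsPowerSpreadProfile V) : IsTameC2Profile ρ V := by
  obtain ⟨⟨δ, Cup, R₀, hδ, hδ1, hCup, hae⟩, -⟩ := hps
  have hall := bound_of_ae_bound hV.continuous hδ1 hae
  have h2ρ : 0 < 2 + ρ := by linarith
  set κ : ℝ := 1 / (2 * (2 + ρ)) with hκ
  have hκpos : 0 < κ := by positivity
  have hκlt : κ < 1 / (2 + ρ) := by
    rw [hκ, div_lt_div_iff_of_pos_left one_pos (by positivity) h2ρ]
    linarith
  set R₁ : ℝ := max (max R₀ 0 + 1) ((Cup / κ) ^ (1 / δ)) with hR₁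
  refine ⟨hV, Or.inl ⟨κ, R₁, hκlt, fun y hy => ?_⟩⟩
  have hyR₀ : R₀ < ‖y‖ := by
    have : max R₀ 0 + 1 ≤ ‖y‖ := le_trans (le_max_left _ _) hy
    linarith [le_max_left R₀ 0]
  have hypos : 0 < ‖y‖ := by
    have : max R₀ 0 + 1 ≤ ‖y‖ := le_trans (le_max_left _ _) hy
    linarith [le_max_right R₀ 0]
  have hyδ : Cup / κ ≤ ‖y‖ ^ δ := by
    have h1 : (Cup / κ) ^ (1 / δ) ≤ ‖y‖ := le_trans (le_max_right _ _) hy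
    have h2 : 0 ≤ Cup / κ := by positivity
    calc Cup / κ = ((Cup / κ) ^ (1 / δ)) ^ δ := by
          rw [← Real.rpow_mul h2, one_div_mul_cancel hδ.ne', Real.rpow_one]
      _ ≤ ‖y‖ ^ δ := Real.rpow_le_rpow (Real.rpow_nonneg h2 _) h1 hδ.le
  have hbound : Cup * ‖y‖ ^ (1 - δ) ≤ κ * ‖y‖ := by
    rw [Real.rpow_sub hypos, Real.rpow_one, mul_div_assoc']
    rw [div_le_iff₀ (Real.rpow_pos_of_pos hypos δ)]
    have : Cup ≤ κ * ‖y‖ ^ δ := by rwa [div_le_iff₀' hκpos] at hyδ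
    nlinarith [Real.rpow_pos_of_pos hypos δ]
  have h1 : -(‖y‖ * ‖V y‖) ≤ inner ℝ y (V y) := neg_le_of_abs_le (abs_real_inner_le_norm y (V y))
  have h2 : ‖y‖ * ‖V y‖ ≤ ‖y‖ * (Cup * ‖y‖ ^ (1 - δ)) := mul_le_mul_of_nonneg_left (hall y hyR₀) (norm_nonneg _)
  have h3 : ‖y‖ * (Cup * ‖y‖ ^ (1 - δ)) ≤ ‖y‖ * (κ * ‖y‖) := mul_le_mul_of_nonneg_left hbound (norm_nonneg _)
  nlinarith


end Summit.NavierStokesRegularity.NavierStokesRegularity.Theorems.PowerGaugeEulerLiouville.Negative
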